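import Literature.Analysis.FluidPDE.KatoPicard
import Literature.Analysis.FluidPDE.NSBoundedMildOseen
import Literature.Analysis.FluidPDE.OseenSliceHolderSeminorm
import Literature.Analysis.FluidPDE.FractionalGronwall
import Literature.Analysis.FluidPDE.KNSSOseenMildDecayTools
import HarnessLib

/-!
# Coiculescu–Palasek 2025, Prop. 4.3 at the level of sup norms: the Picard iteration for the
# correction `w` in the weighted class `‖w(t)‖_∞ ≤ ρ t^{α-1/2}`

Analysis/FluidPDE support file (everything proved; no definitions, no named facts) on the proof
path of the corrected perturbation theorem of M. P. Coiculescu, S. Palasek, *Non-uniqueness of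
smooth solutions of the Navier–Stokes equations from critical data*, Invent. Math. 244 (2025),
arXiv:2503.14699, Props. 4.2–4.3 (hypothesis `hB`, `κ ≤ α`, of
`Literature.Barriers.NavierStokesRegularity.CoiculescuPalasek2025_construction_of_parts'`).

## The statement (`exists_perturbation_fixedPoint`)

Let `ṽ : ℝ → E → E` be a jointly measurable field ("the principal part", lifted to the whole
space) with `‖ṽ(t, y)‖ ≤ ν(t)` on `(0, T]`, `√t ν(t) ≤ K₀`, and let `g` ("the free term
`𝒟[F](t) = ∫₀ᵗ e^{(t-τ)Δ}P∇·F(τ)dτ`") be jointly measurable with `‖g(t, y)‖ ≤ g₀ t^{a-1/2}`,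
`0 < a ≤ 1/2`, `T ≤ 1`. Suppose the resolvent of the scalar Volterra kernel
`2C₀ (t-s)^{-1/2} (ν(s) + s^{a-1/2})` (`C₀ = C₀(E)` the constant of the slice bound
`‖e^{σΔ}P∇·(a ⊗ b)‖_∞ ≤ C₀ σ^{-1/2}‖a‖_∞‖b‖_∞`) is bounded on the profile `t^{a-1/2}` with constant
`C_R` — the output of `LacunaryVolterra.sum_iterate_volterraK_powProfile_le`
(`LacunaryVolterraResolvent.lean`; here an explicit hypothesis, so that this file does not depend
on the lacunarity bookkeeping) — and `g₀ C_R ≤ 1`. Then the Picard iterates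
`w₀ = 0`, `w_{k+1} = Φ(w_k)`,

  `Φ(w) = g - B(ṽ, w) - B(w, ṽ) - B(w, w)`,  `B = oseenDuhamel 1 0`
  (`B(u,v)(t)(x) = ∫_{(0,t)}∫ K(t-τ, x-y)[u(τ,y), v(τ,y)] dy dτ`, the tree's Oseen–Duhamel term),

converge at every point of `(0, T] × E` to a jointly measurable field `w` with
`‖w(t, x)‖ ≤ g₀ C_R t^{a-1/2}`, solving `w = Φ(w)` at every point of `(0, T] × E` (the mild form of
`∂ₜw - Δw + P∇·(2ṽ ⊙ w + w ⊗ w) = P∇·F`, `w(0) = 0`), and inheriting every common period of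
`ṽ` and `g`.

## Proof (the printed fixed point argument, with the linearisation handled by the resolvent)

Prop. 4.3 is proved in the paper by the Banach fixed point theorem for
`T(w) = ∫₀ᵗ S(t,t')(F - w ⊗ w)(t')dt'`, `S` the semigroup of the linearisation (Prop. 4.2). Here
the same contraction is organised as ONE Picard iteration for `Φ` whose differences
`δ_k = w_{k+1} - w_k = -(B(ṽ,δ_{k-1}) + B(δ_{k-1},ṽ) + B(w_k,δ_{k-1}) + B(δ_{k-1},w_{k-1}))` are
majorised pointwise (`‖B(u,v)(t)(x)‖ ≤ ∫ C₀(t-τ)^{-1/2}‖u(τ)‖_∞‖v(τ)‖_∞dτ`,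
`enorm_oseenDuhamel_le_lintegral`) by the scalar chain `D_k = Kᵏ D₀`, `D₀ = g₀ t^{a-1/2}`, of the
Volterra operator `K` with kernel `2C₀(t-s)^{-1/2}(ν(s) + s^{a-1/2})` (the a priori bound
`‖w_k(s)‖ ≤ s^{a-1/2}` being propagated by `g₀ C_R ≤ 1`); `Σ_k D_k ≤ g₀ C_R t^{a-1/2}` is the
resolvent hypothesis, i.e. Prop. 4.2. Hence the iterates converge pointwise, the limit obeys the
bound, and `Φ(w_k) → Φ(w)` because `K` applied to the tails `Σ_{j≥k} D_j` tends to zero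
(monotone convergence), which gives `w = Φ(w)`.

## Mathlib / tree search

Tree: `oseenDuhamel` (`NSBoundedMildOseen.lean`), `oseenSlice`, `exists_norm_oseenSlice_le`,
`integrable_oseenKernel_slice_of_bound`, `stronglyMeasurable_oseenSlice_duhamel`
(`OseenSlice.lean`), `oseenSlice_comp_add_right` (`OseenSliceHolderSeminorm.lean`),
`measurable_uncurry_oseenDuhamel`, `oseenDuhamel_add/neg_left/right_apply` (`KatoPicard.lean`,
whose Picard scheme in Kato's classes is the model of this file), `setIntegral_abel_rpow_rpow_le`
(`FractionalGronwall.lean`). Mathlib: `cauchySeq_of_dist_le_of_summable`,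
`dist_le_tsum_of_dist_le_of_tendsto`, `measurable_of_tendsto_metrizable`, `lintegral_tsum`.

## References

* M. P. Coiculescu, S. Palasek, Invent. Math. 244 (2025) 165–219 = arXiv:2503.14699: §4.2
  Prop. 4.2, §4.3 Prop. 4.3 and its proof (the map `T`, the space `X`, the Duhamel formula for
  `w`). [CoiculescuPalasek2025]
* G. Koch, N. Nadirashvili, G. Seregin, V. Šverák, Acta Math. 203 (2009) = arXiv:0709.3599, §4
  (the bilinear form `B`). [KochNadirashviliSereginSverak2009]
-/

noncomputable section

open MeasureTheory Set Function Filter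
open _root_.Topology
open scoped ENNReal NNReal

namespace Literature.Analysis.FluidPDE

namespace CP25Picard

variable {E : Type*} [NormedAddCommGroup E] [InnerProductSpace ℝ E] [FiniteDimensional ℝ E]
  [MeasurableSpace E] [BorelSpace E]

/-! ## The slice and the Duhamel term against `ℝ≥0∞` majorants -/

/-- **`L¹` bound of the kernel slice against pointwise bounds**: there is `C₀ = C₀(E) > 0` with
`∫ ‖K(σ, x - y)[a(y), b(y)]‖ dy ≤ C₀ σ^{-1/2} M_a M_b` whenever `‖a‖ ≤ M_a`, `‖b‖ ≤ M_b`
(Koch–Tataru's bound (14) integrated; the same constant as `exists_norm_oseenSlice_le`).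
[cite: KochNadirashviliSereginSverak2009, §3 (3.5) and §4 p. 8 (arXiv:0709.3599)] -/
theorem exists_lintegral_enorm_oseenKernel_slice_le :
    ∃ C₀ : ℝ, 0 < C₀ ∧ ∀ {σ : ℝ}, 0 < σ → ∀ {a b : E → E} {Ma Mb : ℝ},
      (∀ y, ‖a y‖ ≤ Ma) → (∀ y, ‖b y‖ ≤ Mb) → ∀ x,
        ∫⁻ y, ‖oseenKernel σ (x - y) (a y) (b y)‖ₑ ≤
          ENNReal.ofReal (C₀ * σ ^ (-(1 / 2 : ℝ)) * Ma * Mb) := by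
  obtain ⟨C, hC, hK⟩ := exists_norm_oseenKernel_le (E := E)
  set I : ℝ := ∫ w : E, (1 + ‖w‖ ^ 2) ^ (-(((Module.finrank ℝ E : ℝ) + 1) / 2)) with hI
  have hI0 : 0 < I := integral_one_add_norm_sq_rpow_neg_pos (by linarith)
  refine ⟨C * I, by positivity, fun {σ} hσ {a b Ma Mb} ha hb x => ?_⟩
  have hMa : 0 ≤ Ma := (norm_nonneg _).trans (ha x)
  have hMb : 0 ≤ Mb := (norm_nonneg _).trans (hb x)
  have hw := ((integrable_add_norm_sq_rpow_neg_half_succ (E := E) hσ).comp_sub_left x).const_mul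
    (C * Ma * Mb)
  calc ∫⁻ y, ‖oseenKernel σ (x - y) (a y) (b y)‖ₑ
      ≤ ∫⁻ y, ENNReal.ofReal (C * Ma * Mb *
          (σ + ‖x - y‖ ^ 2) ^ (-(((Module.finrank ℝ E : ℝ) + 1) / 2))) := by
        refine lintegral_mono fun y => ?_
        rw [← ofReal_norm]
        exact ENNReal.ofReal_le_ofReal (norm_oseenKernel_apply_le_weight hK hC.le hσ ha hb x y)
    _ = ENNReal.ofReal (∫ y, C * Ma * Mb *
          (σ + ‖x - y‖ ^ 2) ^ (-(((Module.finrank ℝ E : ℝ) + 1) / 2))) := by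
        rw [ofReal_integral_eq_lintegral_ofReal hw]
        exact Eventually.of_forall fun y => mul_nonneg (by positivity)
          (Real.rpow_nonneg (by positivity) _)
    _ = ENNReal.ofReal (C * I * σ ^ (-(1 / 2 : ℝ)) * Ma * Mb) := by
        rw [integral_const_mul, integral_sub_left_eq_self (μ := volume)
          (fun z : E => (σ + ‖z‖ ^ 2) ^ (-(((Module.finrank ℝ E : ℝ) + 1) / 2))) x,
          integral_add_norm_sq_rpow_neg_half_succ hσ, ← hI]
        ring_nf

/-- **The Duhamel term against `ℝ≥0∞` majorants.** If `‖u(τ, y)‖ ≤ M_u(τ)`, `‖v(τ, y)‖ ≤ M_v(τ)`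
for `τ ∈ (s, t)`, then
`‖B¹ₛ(u, v)(t)(x)‖ ≤ ∫_{(s,t)} C₀ (t-τ)^{-1/2} M_u(τ) M_v(τ) dτ` in `ℝ≥0∞` (no convergence needed:
`‖∫f‖ ≤ ∫‖f‖` twice and the slice bound). [cite: KochNadirashviliSereginSverak2009, §4 p. 8 (the bound for B) (arXiv:0709.3599)] -/
theorem enorm_oseenDuhamel_le_lintegral {C₀ : ℝ}
    (hC₀ : ∀ {σ : ℝ}, 0 < σ → ∀ {a b : E → E} {Ma Mb : ℝ},
      (∀ y, ‖a y‖ ≤ Ma) → (∀ y, ‖b y‖ ≤ Mb) → ∀ x,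
        ∫⁻ y, ‖oseenKernel σ (x - y) (a y) (b y)‖ₑ ≤ ENNReal.ofReal (C₀ * σ ^ (-(1 / 2 : ℝ)) * Ma * Mb))
    {u v : ℝ → E → E} {s t : ℝ} {Mu Mv : ℝ → ℝ}
    (hu : ∀ τ ∈ Ioo s t, ∀ y, ‖u τ y‖ ≤ Mu τ) (hv : ∀ τ ∈ Ioo s t, ∀ y, ‖v τ y‖ ≤ Mv τ) (x : E) :
    ‖oseenDuhamel 1 s u v t x‖ₑ ≤
      ∫⁻ τ in Ioo s t, ENNReal.ofReal (C₀ * (t - τ) ^ (-(1 / 2 : ℝ)) * Mu τ * Mv τ) := by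
  rw [oseenDuhamel_apply]
  refine (enorm_integral_le_lintegral_enorm _).trans ?_
  refine setLIntegral_mono' measurableSet_Ioo fun τ hτ => ?_
  refine (enorm_integral_le_lintegral_enorm _).trans ?_
  have h := hC₀ (σ := 1 * (t - τ)) (by linarith [hτ.2]) (hu τ hτ) (hv τ hτ) x
  have e : (1 : ℝ) * (t - τ) = t - τ := one_mul _
  simp only [e] at h ⊢
  exact h

/-- **Differences fall on the data**: `B(u,v) - B(u,v')` against majorants of `u` and `v - v'`,
when the four inner integrals converge (bilinearity of the Oseen kernel).
[cite: KochNadirashviliSereginSverak2009, §4 p. 8 (bilinearity of B) (arXiv:0709.3599)] -/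
theorem oseenDuhamel_sub_right_eq {u v v' : ℝ → E → E} {t : ℝ} {x : E}
    (hi : ∀ τ ∈ Ioo 0 t, Integrable (fun y => oseenKernel (1 * (t - τ)) (x - y) (u τ y) (v τ y)) volume)
    (hi' : ∀ τ ∈ Ioo 0 t, Integrable (fun y => oseenKernel (1 * (t - τ)) (x - y) (u τ y) (v' τ y)) volume)
    (hI : IntegrableOn (fun τ => ∫ y, oseenKernel (1 * (t - τ)) (x - y) (u τ y) (v τ y)) (Ioo 0 t) volume)
    (hI' : IntegrableOn (fun τ => ∫ y, oseenKernel (1 * (t - τ)) (x - y) (u τ y) (v' τ y)) (Ioo 0 t) volume) :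
    oseenDuhamel 1 0 u v t x - oseenDuhamel 1 0 u v' t x = oseenDuhamel 1 0 u (v - v') t x := by
  simp only [oseenDuhamel_apply]
  rw [← integral_sub hI hI']
  refine setIntegral_congr_fun measurableSet_Ioo fun τ hτ => ?_
  rw [← integral_sub (hi τ hτ) (hi' τ hτ)]
  refine integral_congr_ae (Eventually.of_forall fun y => ?_)
  simp only [Pi.sub_apply, oseenKernel_sub_right]

/-- `B(u,v) - B(u',v) = B(u - u', v)` when the four inner integrals converge.
[cite: KochNadirashviliSereginSverak2009, §4 p. 8 (bilinearity of B) (arXiv:0709.3599)] -/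
theorem oseenDuhamel_sub_left_eq {u u' v : ℝ → E → E} {t : ℝ} {x : E}
    (hi : ∀ τ ∈ Ioo 0 t, Integrable (fun y => oseenKernel (1 * (t - τ)) (x - y) (u τ y) (v τ y)) volume)
    (hi' : ∀ τ ∈ Ioo 0 t, Integrable (fun y => oseenKernel (1 * (t - τ)) (x - y) (u' τ y) (v τ y)) volume)
    (hI : IntegrableOn (fun τ => ∫ y, oseenKernel (1 * (t - τ)) (x - y) (u τ y) (v τ y)) (Ioo 0 t) volume)
    (hI' : IntegrableOn (fun τ => ∫ y, oseenKernel (1 * (t - τ)) (x - y) (u' τ y) (v τ y)) (Ioo 0 t) volume) :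
    oseenDuhamel 1 0 u v t x - oseenDuhamel 1 0 u' v t x = oseenDuhamel 1 0 (u - u') v t x := by
  simp only [oseenDuhamel_apply]
  rw [← integral_sub hI hI']
  refine setIntegral_congr_fun measurableSet_Ioo fun τ hτ => ?_
  rw [← integral_sub (hi τ hτ) (hi' τ hτ)]
  refine integral_congr_ae (Eventually.of_forall fun y => ?_)
  simp only [Pi.sub_apply, oseenKernel_sub_left]

/-! ## Convergence of the inner and outer integrals for profile-bounded fields -/

/-- The inner integral converges for bounded measurable slices. [folklore] -/
theorem integrable_oseenKernel_slice' {u v : ℝ → E → E} (hum : Measurable (uncurry u))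
    (hvm : Measurable (uncurry v)) {t τ : ℝ} (hτ : τ < t) {Mu Mv : ℝ}
    (hu : ∀ y, ‖u τ y‖ ≤ Mu) (hv : ∀ y, ‖v τ y‖ ≤ Mv) (x : E) :
    Integrable (fun y => oseenKernel (1 * (t - τ)) (x - y) (u τ y) (v τ y)) volume :=
  integrable_oseenKernel_slice_of_bound (by linarith)
    (hum.of_uncurry_left (x := τ)).aestronglyMeasurable
    (hvm.of_uncurry_left (x := τ)).aestronglyMeasurable hu hv x

/-- **The time integrand is integrable when dominated**: if `‖u(τ)‖ ≤ M_u(τ)`, `‖v(τ)‖ ≤ M_v(τ)` on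
`(0, t)` and `(t-τ)^{-1/2} M_u(τ) M_v(τ)` is integrable on `(0, t)`, then so is
`τ ↦ ∫ K(t-τ, x-y)[u(τ,y), v(τ,y)] dy` (slice bound `C₀(t-τ)^{-1/2}M_uM_v`). [folklore] -/
theorem integrableOn_oseenIntegrand_of_dominated {u v : ℝ → E → E} (hum : Measurable (uncurry u))
    (hvm : Measurable (uncurry v)) {t : ℝ} {Mu Mv : ℝ → ℝ}
    (hu : ∀ τ ∈ Ioo 0 t, ∀ y, ‖u τ y‖ ≤ Mu τ) (hv : ∀ τ ∈ Ioo 0 t, ∀ y, ‖v τ y‖ ≤ Mv τ)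
    (hdom : IntegrableOn (fun τ => (t - τ) ^ (-(1 / 2 : ℝ)) * (Mu τ * Mv τ)) (Ioo 0 t) volume)
    (x : E) :
    IntegrableOn (fun τ => ∫ y, oseenKernel (1 * (t - τ)) (x - y) (u τ y) (v τ y)) (Ioo 0 t) volume := by
  obtain ⟨C₀, hC₀, hN⟩ := exists_norm_oseenSlice_le (E := E)
  have hmeas : AEStronglyMeasurable (fun τ => ∫ y, oseenKernel (1 * (t - τ)) (x - y) (u τ y) (v τ y))
      (volume.restrict (Ioo 0 t)) :=
    ((stronglyMeasurable_oseenSlice_duhamel 1 t hum hvm).comp_measurable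
      (measurable_id.prodMk measurable_const)).aestronglyMeasurable
  refine Integrable.mono' (hdom.const_mul C₀) hmeas ?_
  refine (ae_restrict_iff' measurableSet_Ioo).2 (Eventually.of_forall fun τ hτ => ?_)
  have h := hN (σ := 1 * (t - τ)) (by linarith [hτ.2]) (hu τ hτ) (hv τ hτ) x
  rw [oseenSlice_apply, one_mul] at h
  calc ‖∫ y, oseenKernel (1 * (t - τ)) (x - y) (u τ y) (v τ y)‖
      ≤ C₀ * (t - τ) ^ (-(1 / 2 : ℝ)) * Mu τ * Mv τ := by simpa only [one_mul] using h
    _ = C₀ * ((t - τ) ^ (-(1 / 2 : ℝ)) * (Mu τ * Mv τ)) := by ring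

/-- The Abel weight for one Kato-bounded and one subcritical factor:
`(t-τ)^{-1/2} · (Aτ^{-1/2})(Bτ^{a-1/2}) = AB (t-τ)^{-1/2}τ^{a-1}` is integrable on `(0,t)` (`a > 0`).
[folklore] -/
theorem integrableOn_abel_kato_subcritical {t A B a : ℝ} (ht : 0 < t) (ha : 0 < a) (ha1 : a ≤ 1) :
    IntegrableOn (fun τ => (t - τ) ^ (-(1 / 2 : ℝ)) * (A * τ ^ (-(1 / 2 : ℝ)) * (B * τ ^ (a - 1 / 2))))
      (Ioo 0 t) volume := by
  obtain ⟨hint, -⟩ := setIntegral_abel_rpow_rpow_le (a := 1 / 2) (b := 1 - a) (t := t)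
    (by norm_num) (by norm_num) (by linarith) (by linarith) ht
  have h2 : IntegrableOn (fun τ => A * B * ((t - τ) ^ (-(1 / 2 : ℝ)) * τ ^ (-(1 - a))))
      (Ioo 0 t) volume := hint.const_mul (A * B)
  refine h2.congr_fun (fun τ hτ => ?_) measurableSet_Ioo
  have hτ0 : 0 < τ := hτ.1
  have h1 : τ ^ (-(1 / 2 : ℝ)) * τ ^ (a - 1 / 2) = τ ^ (-(1 - a)) := by
    rw [← Real.rpow_add hτ0]; ring_nf
  calc A * B * ((t - τ) ^ (-(1 / 2 : ℝ)) * τ ^ (-(1 - a)))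
      = (t - τ) ^ (-(1 / 2 : ℝ)) * (A * B * (τ ^ (-(1 / 2 : ℝ)) * τ ^ (a - 1 / 2))) := by rw [h1]; ring
    _ = _ := by ring

/-- The symmetric Abel weight (subcritical factor first). [folklore] -/
theorem integrableOn_abel_subcritical_kato {t A B a : ℝ} (ht : 0 < t) (ha : 0 < a) (ha1 : a ≤ 1) :
    IntegrableOn (fun τ => (t - τ) ^ (-(1 / 2 : ℝ)) * (B * τ ^ (a - 1 / 2) * (A * τ ^ (-(1 / 2 : ℝ)))))
      (Ioo 0 t) volume := by
  refine (integrableOn_abel_kato_subcritical (A := A) (B := B) ht ha ha1).congr_fun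
    (fun τ _ => ?_) measurableSet_Ioo
  ring

/-- A subcritical bound is a Kato bound on `(0, 1]`: `B τ^{a-1/2} ≤ B τ^{-1/2}` for `0 < τ ≤ 1`,
`0 ≤ a`, `0 ≤ B`. [folklore] -/
theorem subcritical_le_kato {τ B a : ℝ} (hτ : 0 < τ) (hτ1 : τ ≤ 1) (ha : 0 ≤ a) (hB : 0 ≤ B) :
    B * τ ^ (a - 1 / 2) ≤ B * τ ^ (-(1 / 2 : ℝ)) := by
  refine mul_le_mul_of_nonneg_left ?_ hB
  exact Real.rpow_le_rpow_of_exponent_ge hτ hτ1 (by linarith)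

/-! ## The scalar majorant operator: measurability -/

/-- Parametric measurability of `t ↦ ∫_{(0,t)} κ(t, s) f(s) ds` in `ℝ≥0∞`. [folklore] -/
theorem measurable_volterraOp {κ : ℝ × ℝ → ℝ≥0∞} (hκ : Measurable κ) {f : ℝ → ℝ≥0∞}
    (hf : Measurable f) : Measurable fun t => ∫⁻ s in Ioo 0 t, κ (t, s) * f s := by
  set H : ℝ × ℝ → ℝ≥0∞ := fun r => if r.2 ∈ Ioo 0 r.1 then κ r * f r.2 else 0 with hH
  have hHm : Measurable H := by
    refine Measurable.ite ?_ (hκ.mul (hf.comp measurable_snd)) measurable_const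
    show MeasurableSet {r : ℝ × ℝ | r.2 ∈ Ioo 0 r.1}
    have : {r : ℝ × ℝ | r.2 ∈ Ioo 0 r.1} = {r | (0 : ℝ) < r.2} ∩ {r | r.2 < r.1} := by
      ext r; simp [Ioo]
    rw [this]
    exact (measurableSet_lt measurable_const measurable_snd).inter
      (measurableSet_lt measurable_snd measurable_fst)
  have key : ∀ t, ∫⁻ s in Ioo 0 t, κ (t, s) * f s = ∫⁻ s, H (t, s) := by
    intro t
    rw [← lintegral_indicator measurableSet_Ioo]
    congr 1
    funext s
    rw [Set.indicator_apply]
  simp_rw [key]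
  exact hHm.lintegral_prod_right'

/-! ## The core estimate: differences of the quadratic-linear part against a majorant -/

omit [InnerProductSpace ℝ E] [FiniteDimensional ℝ E] [MeasurableSpace E] [BorelSpace E] in
/-- Real bound from an `ℝ≥0∞` majorant. [folklore] -/
theorem norm_le_toReal_of_enorm_le {x : E} {M : ℝ≥0∞} (h : ‖x‖ₑ ≤ M) (hM : M ≠ ∞) :
    ‖x‖ ≤ M.toReal := by
  rw [← toReal_enorm]
  exact ENNReal.toReal_mono hM h

/-- **The core estimate of the Picard scheme.** Let `S(w) = B(ṽ, w) + B(w, ṽ) + B(w, w)` at a point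
`(t, x)`, `t ∈ (0, T]`, `T ≤ 1`. If `‖ṽ(τ)‖ ≤ ν(τ) ≤ K₀τ^{-1/2}`, `‖wᵢ(τ)‖ ≤ τ^{a-1/2}` (`i = 0, 1`) and
`‖w₁(τ) - w₀(τ)‖ ≤ M(τ) < ∞` on `(0, T]`, then

  `‖S(w₁) - S(w₀)‖ ≤ ∫_{(0,t)} 2C₀ (t-τ)^{-1/2} (ν(τ) + τ^{a-1/2}) M(τ) dτ`:

`S(w₁) - S(w₀) = B(ṽ, δ) + B(δ, ṽ) + B(w₁, δ) + B(δ, w₀)`, `δ = w₁ - w₀` (bilinearity, all integrals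
converging absolutely), and each term is bounded slice by slice. This is the estimate
"`‖T(w₁) - T(w₂)‖_X ≲ ‖w₁ - w₂‖_X(‖w₁‖_X + ‖w₂‖_X)`" of the printed proof together with the linear part,
before the resolvent is applied. [cite: CoiculescuPalasek2025, proof of Prop. 4.3] -/
theorem enorm_quadratic_sub_le {C₀ : ℝ} (hC₀0 : 0 < C₀)
    (hC₀ : ∀ {σ : ℝ}, 0 < σ → ∀ {a b : E → E} {Ma Mb : ℝ},
      (∀ y, ‖a y‖ ≤ Ma) → (∀ y, ‖b y‖ ≤ Mb) → ∀ x,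
        ∫⁻ y, ‖oseenKernel σ (x - y) (a y) (b y)‖ₑ ≤ ENNReal.ofReal (C₀ * σ ^ (-(1 / 2 : ℝ)) * Ma * Mb))
    {T a K₀ : ℝ} (hT1 : T ≤ 1) (ha : 0 < a) (ha1 : a ≤ 1 / 2)
    {ν : ℝ → ℝ} (hν0 : ∀ s ∈ Ioc 0 T, 0 ≤ ν s) (h313a : ∀ s ∈ Ioc 0 T, Real.sqrt s * ν s ≤ K₀)
    {vt w₁ w₀ : ℝ → E → E} (hvtm : Measurable (uncurry vt)) (hw₁m : Measurable (uncurry w₁))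
    (hw₀m : Measurable (uncurry w₀)) (hvt : ∀ τ ∈ Ioc 0 T, ∀ y, ‖vt τ y‖ ≤ ν τ)
    (hw₁ : ∀ τ ∈ Ioc 0 T, ∀ y, ‖w₁ τ y‖ ≤ τ ^ (a - 1 / 2))
    (hw₀ : ∀ τ ∈ Ioc 0 T, ∀ y, ‖w₀ τ y‖ ≤ τ ^ (a - 1 / 2))
    {M : ℝ → ℝ≥0∞} (hMfin : ∀ τ ∈ Ioc 0 T, M τ ≠ ∞)
    (hM : ∀ τ ∈ Ioc 0 T, ∀ y, ‖w₁ τ y - w₀ τ y‖ₑ ≤ M τ)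
    {t : ℝ} (ht : t ∈ Ioc 0 T) (x : E) :
    ‖(oseenDuhamel 1 0 vt w₁ t x + oseenDuhamel 1 0 w₁ vt t x + oseenDuhamel 1 0 w₁ w₁ t x) -
        (oseenDuhamel 1 0 vt w₀ t x + oseenDuhamel 1 0 w₀ vt t x + oseenDuhamel 1 0 w₀ w₀ t x)‖ₑ ≤
      ∫⁻ τ in Ioo 0 t, ENNReal.ofReal (2 * C₀ * (t - τ) ^ (-(1 / 2 : ℝ)) * (ν τ + τ ^ (a - 1 / 2))) * M τ := by
  have ht0 : 0 < t := ht.1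
  have hsub : ∀ τ ∈ Ioo 0 t, τ ∈ Ioc 0 T := fun τ hτ => ⟨hτ.1, hτ.2.le.trans ht.2⟩
  -- Kato bound of `ṽ`
  have hK : 0 ≤ K₀ := le_trans (mul_nonneg (Real.sqrt_nonneg _) (hν0 t ht)) (h313a t ht)
  have hνK : ∀ τ ∈ Ioc 0 T, ν τ ≤ K₀ * τ ^ (-(1 / 2 : ℝ)) := by
    intro τ hτ
    have h := h313a τ hτ
    have h1 : Real.sqrt τ * τ ^ (-(1 / 2 : ℝ)) = 1 := by
      rw [Real.sqrt_eq_rpow, ← Real.rpow_add hτ.1]; norm_num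
    calc ν τ = (Real.sqrt τ * ν τ) * τ ^ (-(1 / 2 : ℝ)) := by
          calc ν τ = (Real.sqrt τ * τ ^ (-(1 / 2 : ℝ))) * ν τ := by rw [h1, one_mul]
            _ = _ := by ring
      _ ≤ K₀ * τ ^ (-(1 / 2 : ℝ)) := mul_le_mul_of_nonneg_right h (Real.rpow_nonneg hτ.1.le _)
  -- the difference field and its real majorant
  set δ : ℝ → E → E := w₁ - w₀ with hδ
  have hδm : Measurable (uncurry δ) := hw₁m.sub hw₀m
  have hδ_apply : ∀ τ y, δ τ y = w₁ τ y - w₀ τ y := fun τ y => rfl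
  have hδM : ∀ τ ∈ Ioc 0 T, ∀ y, ‖δ τ y‖ ≤ (M τ).toReal := fun τ hτ y =>
    norm_le_toReal_of_enorm_le (hM τ hτ y) (hMfin τ hτ)
  have hδsub : ∀ τ ∈ Ioc 0 T, ∀ y, ‖δ τ y‖ ≤ 2 * τ ^ (a - 1 / 2) := by
    intro τ hτ y
    calc ‖δ τ y‖ = ‖w₁ τ y - w₀ τ y‖ := rfl
      _ ≤ ‖w₁ τ y‖ + ‖w₀ τ y‖ := norm_sub_le _ _
      _ ≤ τ ^ (a - 1 / 2) + τ ^ (a - 1 / 2) := add_le_add (hw₁ τ hτ y) (hw₀ τ hτ y)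
      _ = 2 * τ ^ (a - 1 / 2) := by ring
  -- Kato bounds for the subcritical fields on `(0, t)`, `t ≤ 1`
  have hkato : ∀ {w : ℝ → E → E} {B : ℝ}, 0 ≤ B → (∀ τ ∈ Ioc 0 T, ∀ y, ‖w τ y‖ ≤ B * τ ^ (a - 1 / 2)) →
      ∀ τ ∈ Ioo 0 t, ∀ y, ‖w τ y‖ ≤ B * τ ^ (-(1 / 2 : ℝ)) := by
    intro w B hB hw τ hτ y
    exact (hw τ (hsub τ hτ) y).trans
      (subcritical_le_kato hτ.1 (hτ.2.le.trans (ht.2.trans hT1)) ha.le hB)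
  have hw₁' : ∀ τ ∈ Ioc 0 T, ∀ y, ‖w₁ τ y‖ ≤ 1 * τ ^ (a - 1 / 2) := fun τ hτ y => by
    rw [one_mul]; exact hw₁ τ hτ y
  have hw₀' : ∀ τ ∈ Ioc 0 T, ∀ y, ‖w₀ τ y‖ ≤ 1 * τ ^ (a - 1 / 2) := fun τ hτ y => by
    rw [one_mul]; exact hw₀ τ hτ y
  have ha1' : a ≤ 1 := by linarith
  -- integrability of the time integrands
  have I_vt : ∀ {w : ℝ → E → E} {B : ℝ}, Measurable (uncurry w) → 0 ≤ B →
      (∀ τ ∈ Ioc 0 T, ∀ y, ‖w τ y‖ ≤ B * τ ^ (a - 1 / 2)) →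
      IntegrableOn (fun τ => ∫ y, oseenKernel (1 * (t - τ)) (x - y) (vt τ y) (w τ y)) (Ioo 0 t) volume ∧
      IntegrableOn (fun τ => ∫ y, oseenKernel (1 * (t - τ)) (x - y) (w τ y) (vt τ y)) (Ioo 0 t) volume := by
    intro w B hwm hB hw
    refine ⟨integrableOn_oseenIntegrand_of_dominated hvtm hwm (fun τ hτ y => (hvt τ (hsub τ hτ) y).trans
        (hνK τ (hsub τ hτ))) (fun τ hτ y => hw τ (hsub τ hτ) y)
        (integrableOn_abel_kato_subcritical ht0 ha ha1') x,
      integrableOn_oseenIntegrand_of_dominated hwm hvtm (fun τ hτ y => hw τ (hsub τ hτ) y)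
        (fun τ hτ y => (hvt τ (hsub τ hτ) y).trans (hνK τ (hsub τ hτ)))
        (integrableOn_abel_subcritical_kato ht0 ha ha1') x⟩
  have I_ww : ∀ {w w' : ℝ → E → E} {B B' : ℝ}, Measurable (uncurry w) → Measurable (uncurry w') →
      0 ≤ B → 0 ≤ B' →
      (∀ τ ∈ Ioc 0 T, ∀ y, ‖w τ y‖ ≤ B * τ ^ (a - 1 / 2)) →
      (∀ τ ∈ Ioc 0 T, ∀ y, ‖w' τ y‖ ≤ B' * τ ^ (a - 1 / 2)) →
      IntegrableOn (fun τ => ∫ y, oseenKernel (1 * (t - τ)) (x - y) (w τ y) (w' τ y)) (Ioo 0 t) volume := by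
    intro w w' B B' hwm hw'm hB hB' hw hw'
    exact integrableOn_oseenIntegrand_of_dominated hwm hw'm (hkato hB hw)
      (fun τ hτ y => hw' τ (hsub τ hτ) y) (integrableOn_abel_kato_subcritical ht0 ha ha1') x
  -- integrability of the slices
  have S_ : ∀ {u v : ℝ → E → E} {Mu Mv : ℝ → ℝ}, Measurable (uncurry u) → Measurable (uncurry v) →
      (∀ τ ∈ Ioc 0 T, ∀ y, ‖u τ y‖ ≤ Mu τ) → (∀ τ ∈ Ioc 0 T, ∀ y, ‖v τ y‖ ≤ Mv τ) →
      ∀ τ ∈ Ioo 0 t, Integrable (fun y => oseenKernel (1 * (t - τ)) (x - y) (u τ y) (v τ y)) volume := by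
    intro u v Mu Mv hum hvm hu hv τ hτ
    exact integrable_oseenKernel_slice' hum hvm hτ.2 (hu τ (hsub τ hτ)) (hv τ (hsub τ hτ)) x
  -- ### the algebraic decomposition
  have e1 : oseenDuhamel 1 0 vt w₁ t x - oseenDuhamel 1 0 vt w₀ t x = oseenDuhamel 1 0 vt δ t x :=
    oseenDuhamel_sub_right_eq (S_ hvtm hw₁m hvt hw₁) (S_ hvtm hw₀m hvt hw₀)
      (I_vt hw₁m zero_le_one hw₁').1 (I_vt hw₀m zero_le_one hw₀').1
  have e2 : oseenDuhamel 1 0 w₁ vt t x - oseenDuhamel 1 0 w₀ vt t x = oseenDuhamel 1 0 δ vt t x :=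
    oseenDuhamel_sub_left_eq (S_ hw₁m hvtm hw₁ hvt) (S_ hw₀m hvtm hw₀ hvt)
      (I_vt hw₁m zero_le_one hw₁').2 (I_vt hw₀m zero_le_one hw₀').2
  have e3 : oseenDuhamel 1 0 w₁ w₁ t x - oseenDuhamel 1 0 w₁ w₀ t x = oseenDuhamel 1 0 w₁ δ t x :=
    oseenDuhamel_sub_right_eq (S_ hw₁m hw₁m hw₁ hw₁) (S_ hw₁m hw₀m hw₁ hw₀)
      (I_ww hw₁m hw₁m zero_le_one zero_le_one hw₁' hw₁')
      (I_ww hw₁m hw₀m zero_le_one zero_le_one hw₁' hw₀')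
  have e4 : oseenDuhamel 1 0 w₁ w₀ t x - oseenDuhamel 1 0 w₀ w₀ t x = oseenDuhamel 1 0 δ w₀ t x :=
    oseenDuhamel_sub_left_eq (S_ hw₁m hw₀m hw₁ hw₀) (S_ hw₀m hw₀m hw₀ hw₀)
      (I_ww hw₁m hw₀m zero_le_one zero_le_one hw₁' hw₀')
      (I_ww hw₀m hw₀m zero_le_one zero_le_one hw₀' hw₀')
  have halg : (oseenDuhamel 1 0 vt w₁ t x + oseenDuhamel 1 0 w₁ vt t x + oseenDuhamel 1 0 w₁ w₁ t x) -
      (oseenDuhamel 1 0 vt w₀ t x + oseenDuhamel 1 0 w₀ vt t x + oseenDuhamel 1 0 w₀ w₀ t x) =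
      oseenDuhamel 1 0 vt δ t x + oseenDuhamel 1 0 δ vt t x +
        (oseenDuhamel 1 0 w₁ δ t x + oseenDuhamel 1 0 δ w₀ t x) := by
    rw [← e1, ← e2, ← e3, ← e4]; abel
  rw [halg]
  -- ### the four bounds
  have hν' : ∀ τ ∈ Ioo 0 t, ∀ y, ‖vt τ y‖ ≤ ν τ := fun τ hτ y => hvt τ (hsub τ hτ) y
  have hδ' : ∀ τ ∈ Ioo 0 t, ∀ y, ‖δ τ y‖ ≤ (M τ).toReal := fun τ hτ y => hδM τ (hsub τ hτ) y
  have hw₁'' : ∀ τ ∈ Ioo 0 t, ∀ y, ‖w₁ τ y‖ ≤ τ ^ (a - 1 / 2) := fun τ hτ y => hw₁ τ (hsub τ hτ) y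
  have hw₀'' : ∀ τ ∈ Ioo 0 t, ∀ y, ‖w₀ τ y‖ ≤ τ ^ (a - 1 / 2) := fun τ hτ y => hw₀ τ (hsub τ hτ) y
  have b1 := enorm_oseenDuhamel_le_lintegral hC₀ (s := 0) (t := t) hν' hδ' x
  have b2 := enorm_oseenDuhamel_le_lintegral hC₀ (s := 0) (t := t) hδ' hν' x
  have b3 := enorm_oseenDuhamel_le_lintegral hC₀ (s := 0) (t := t) hw₁'' hδ' x
  have b4 := enorm_oseenDuhamel_le_lintegral hC₀ (s := 0) (t := t) hδ' hw₀'' x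
  -- ### pointwise sum of the four integrands
  have hpt : ∀ τ ∈ Ioo 0 t,
      ENNReal.ofReal (C₀ * (t - τ) ^ (-(1 / 2 : ℝ)) * ν τ * (M τ).toReal) +
        ENNReal.ofReal (C₀ * (t - τ) ^ (-(1 / 2 : ℝ)) * (M τ).toReal * ν τ) +
        (ENNReal.ofReal (C₀ * (t - τ) ^ (-(1 / 2 : ℝ)) * τ ^ (a - 1 / 2) * (M τ).toReal) +
          ENNReal.ofReal (C₀ * (t - τ) ^ (-(1 / 2 : ℝ)) * (M τ).toReal * τ ^ (a - 1 / 2))) =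
      ENNReal.ofReal (2 * C₀ * (t - τ) ^ (-(1 / 2 : ℝ)) * (ν τ + τ ^ (a - 1 / 2))) * M τ := by
    intro τ hτ
    have hk : 0 ≤ C₀ * (t - τ) ^ (-(1 / 2 : ℝ)) := mul_nonneg hC₀0.le (Real.rpow_nonneg (by linarith [hτ.2]) _)
    have hν0' : 0 ≤ ν τ := hν0 τ (hsub τ hτ)
    have hp : 0 ≤ τ ^ (a - 1 / 2) := Real.rpow_nonneg hτ.1.le _
    have hMr : 0 ≤ (M τ).toReal := ENNReal.toReal_nonneg
    have n1 : 0 ≤ C₀ * (t - τ) ^ (-(1 / 2 : ℝ)) * ν τ * (M τ).toReal := by positivity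
    have n2 : 0 ≤ C₀ * (t - τ) ^ (-(1 / 2 : ℝ)) * (M τ).toReal * ν τ := by positivity
    have n3 : 0 ≤ C₀ * (t - τ) ^ (-(1 / 2 : ℝ)) * τ ^ (a - 1 / 2) * (M τ).toReal := by positivity
    have n4 : 0 ≤ C₀ * (t - τ) ^ (-(1 / 2 : ℝ)) * (M τ).toReal * τ ^ (a - 1 / 2) := by positivity
    rw [← ENNReal.ofReal_add n1 n2, ← ENNReal.ofReal_add n3 n4,
      ← ENNReal.ofReal_add (add_nonneg n1 n2) (add_nonneg n3 n4),
      ← ENNReal.ofReal_toReal (hMfin τ (hsub τ hτ)),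
      ← ENNReal.ofReal_mul (mul_nonneg (mul_nonneg (by positivity)
        (Real.rpow_nonneg (by linarith [hτ.2]) _)) (add_nonneg hν0' hp)), ENNReal.toReal_ofReal hMr]
    congr 1
    ring
  calc ‖oseenDuhamel 1 0 vt δ t x + oseenDuhamel 1 0 δ vt t x +
        (oseenDuhamel 1 0 w₁ δ t x + oseenDuhamel 1 0 δ w₀ t x)‖ₑ
      ≤ ‖oseenDuhamel 1 0 vt δ t x‖ₑ + ‖oseenDuhamel 1 0 δ vt t x‖ₑ +
          (‖oseenDuhamel 1 0 w₁ δ t x‖ₑ + ‖oseenDuhamel 1 0 δ w₀ t x‖ₑ) :=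
        (enorm_add_le _ _).trans (add_le_add (enorm_add_le _ _) (enorm_add_le _ _))
    _ ≤ _ := add_le_add (add_le_add b1 b2) (add_le_add b3 b4)
    _ ≤ ∫⁻ τ in Ioo 0 t, (ENNReal.ofReal (C₀ * (t - τ) ^ (-(1 / 2 : ℝ)) * ν τ * (M τ).toReal) +
          ENNReal.ofReal (C₀ * (t - τ) ^ (-(1 / 2 : ℝ)) * (M τ).toReal * ν τ) +
          (ENNReal.ofReal (C₀ * (t - τ) ^ (-(1 / 2 : ℝ)) * τ ^ (a - 1 / 2) * (M τ).toReal) +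
            ENNReal.ofReal (C₀ * (t - τ) ^ (-(1 / 2 : ℝ)) * (M τ).toReal * τ ^ (a - 1 / 2)))) := by
        refine le_trans (add_le_add (le_lintegral_add _ _) (le_lintegral_add _ _)) ?_
        exact le_lintegral_add _ _
    _ = _ := setLIntegral_congr_fun measurableSet_Ioo hpt

/-! ## The fixed point -/

/-- **Coiculescu–Palasek, Prop. 4.3 at the level of sup norms (existence of the correction `w` as a
pointwise fixed point of the mild map).** See the module docstring for the statement and the
proof. The resolvent hypothesis `hR` is the conclusion of
`LacunaryVolterra.tsum_iterate_volterraK_powProfile_le` for the kernel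
`2C₀(t-s)^{-1/2}(ν(s) + s^{a-1/2})`, `C₀` the constant produced here.
[cite: CoiculescuPalasek2025, Prop. 4.3 and its proof (the map T, the ball B_X(0, ε₁), the Banach fixed point theorem)] -/
theorem exists_perturbation_fixedPoint :
    ∃ C₀ : ℝ, 0 < C₀ ∧
    ∀ {T a K₀ g₀ CR : ℝ} {ν : ℝ → ℝ} {vt g : ℝ → E → E},
      0 < T → T ≤ 1 → 0 < a → a ≤ 1 / 2 → 0 ≤ g₀ → 0 ≤ CR → g₀ * CR ≤ 1 →
      Measurable ν → (∀ s ∈ Ioc 0 T, 0 ≤ ν s) → (∀ s ∈ Ioc 0 T, Real.sqrt s * ν s ≤ K₀) →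
      Measurable (uncurry vt) → Measurable (uncurry g) →
      (∀ t ∈ Ioc 0 T, ∀ y, ‖vt t y‖ ≤ ν t) →
      (∀ t ∈ Ioc 0 T, ∀ y, ‖g t y‖ ≤ g₀ * t ^ (a - 1 / 2)) →
      (∀ t ∈ Ioc 0 T, ∑' n, ((fun (f : ℝ → ℝ≥0∞) (t : ℝ) => ∫⁻ s in Ioo 0 t,
          ENNReal.ofReal (2 * C₀ * (t - s) ^ (-(1 / 2 : ℝ)) * (ν s + s ^ (a - 1 / 2))) * f s)^[n])
          (fun s => ENNReal.ofReal (s ^ (a - 1 / 2))) t ≤ ENNReal.ofReal (CR * t ^ (a - 1 / 2))) →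
      ∃ w : ℝ → E → E, Measurable (uncurry w) ∧
        (∀ t ∈ Ioc 0 T, ∀ x, ‖w t x‖ ≤ g₀ * CR * t ^ (a - 1 / 2)) ∧
        (∀ t ∈ Ioc 0 T, ∀ x, w t x = g t x - oseenDuhamel 1 0 vt w t x - oseenDuhamel 1 0 w vt t x -
          oseenDuhamel 1 0 w w t x) ∧
        (∀ t, t ∉ Ioc 0 T → ∀ x, w t x = 0) ∧
        (∀ h : E, (∀ t y, vt t (y + h) = vt t y) → (∀ t y, g t (y + h) = g t y) →
          ∀ t y, w t (y + h) = w t y) := by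
  obtain ⟨C₀, hC₀0, hC₀⟩ := exists_lintegral_enorm_oseenKernel_slice_le (E := E)
  refine ⟨C₀, hC₀0, ?_⟩
  intro T a K₀ g₀ CR ν vt g hT hT1 ha ha2 hg₀ hCR hsmall hνm hν0 h313a hvtm hgm hvt hg hR
  -- ### the scalar majorants
  set p : ℝ → ℝ≥0∞ := fun s => ENNReal.ofReal (s ^ (a - 1 / 2)) with hp
  set Kop : (ℝ → ℝ≥0∞) → ℝ → ℝ≥0∞ := fun f t => ∫⁻ s in Ioo 0 t,
    ENNReal.ofReal (2 * C₀ * (t - s) ^ (-(1 / 2 : ℝ)) * (ν s + s ^ (a - 1 / 2))) * f s with hKop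
  set D : ℕ → ℝ → ℝ≥0∞ := fun k t => ENNReal.ofReal g₀ * (Kop^[k] p) t with hD
  have hκm : Measurable fun r : ℝ × ℝ =>
      ENNReal.ofReal (2 * C₀ * (r.1 - r.2) ^ (-(1 / 2 : ℝ)) * (ν r.2 + r.2 ^ (a - 1 / 2))) :=
    ((measurable_const.mul ((measurable_fst.sub measurable_snd).pow_const _)).mul
      ((hνm.comp measurable_snd).add (measurable_snd.pow_const _))).ennreal_ofReal
  have hKop_meas : ∀ {f : ℝ → ℝ≥0∞}, Measurable f → Measurable (Kop f) := fun hf =>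
    measurable_volterraOp hκm hf
  have hiter_meas : ∀ k, Measurable (Kop^[k] p) := by
    intro k
    induction k with
    | zero => exact (measurable_id.pow_const _).ennreal_ofReal
    | succ k ih => rw [Function.iterate_succ']; exact hKop_meas ih
  have hD_meas : ∀ k, Measurable (D k) := fun k => (hiter_meas k).const_mul _
  have hD0 : ∀ t, 0 < t → D 0 t = ENNReal.ofReal (g₀ * t ^ (a - 1 / 2)) := by
    intro t _
    simp only [hD, Function.iterate_zero, id_eq, hp]
    rw [← ENNReal.ofReal_mul hg₀]
  have hD_succ : ∀ k t, Kop (D k) t = D (k + 1) t := by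
    intro k t
    simp only [hD]
    rw [Function.iterate_succ_apply']
    simp only [hKop]
    rw [← lintegral_const_mul' _ _ ENNReal.ofReal_ne_top]
    refine lintegral_congr fun s => ?_
    ring
  have hD_tsum : ∀ t ∈ Ioc 0 T, ∑' k, D k t ≤ ENNReal.ofReal (g₀ * CR * t ^ (a - 1 / 2)) := by
    intro t ht
    simp only [hD]
    rw [ENNReal.tsum_mul_left, mul_assoc, ENNReal.ofReal_mul hg₀]
    exact mul_le_mul' le_rfl (hR t ht)
  have hD_fin : ∀ k, ∀ t ∈ Ioc 0 T, D k t ≠ ∞ := fun k t ht =>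
    ne_top_of_le_ne_top ENNReal.ofReal_ne_top ((ENNReal.le_tsum k).trans (hD_tsum t ht))
  have hsumD_le : ∀ t ∈ Ioc 0 T, ∑' k, D k t ≤ ENNReal.ofReal (t ^ (a - 1 / 2)) := fun t ht =>
    (hD_tsum t ht).trans (ENNReal.ofReal_le_ofReal (by
      calc g₀ * CR * t ^ (a - 1 / 2) ≤ 1 * t ^ (a - 1 / 2) :=
            mul_le_mul_of_nonneg_right hsmall (Real.rpow_nonneg ht.1.le _)
        _ = _ := one_mul _))
  -- ### the scheme
  set Φ : (ℝ → E → E) → ℝ → E → E := fun w t x =>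
    if t ∈ Ioc 0 T then g t x - oseenDuhamel 1 0 vt w t x - oseenDuhamel 1 0 w vt t x -
      oseenDuhamel 1 0 w w t x else 0 with hΦ
  set W : ℕ → ℝ → E → E := fun k => Φ^[k] 0 with hW
  have hW0 : W 0 = 0 := rfl
  have hWsucc : ∀ k, W (k + 1) = Φ (W k) := fun k => Function.iterate_succ_apply' Φ k _
  have hW_in : ∀ k, ∀ t ∈ Ioc 0 T, ∀ x, W (k + 1) t x = g t x - oseenDuhamel 1 0 vt (W k) t x -
      oseenDuhamel 1 0 (W k) vt t x - oseenDuhamel 1 0 (W k) (W k) t x := by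
    intro k t ht x; rw [hWsucc]; simp only [hΦ, if_pos ht]
  have hW_out : ∀ k t, t ∉ Ioc 0 T → ∀ x, W k t x = 0 := by
    intro k t ht x
    cases k with
    | zero => rfl
    | succ k => rw [hWsucc]; simp only [hΦ, if_neg ht]
  -- measurability of one step
  have hΦm : ∀ {w : ℝ → E → E}, Measurable (uncurry w) → Measurable (uncurry (Φ w)) := by
    intro w hwm
    have h1 : Measurable (uncurry (oseenDuhamel 1 0 vt w)) := measurable_uncurry_oseenDuhamel hvtm hwm 1
    have h2 : Measurable (uncurry (oseenDuhamel 1 0 w vt)) := measurable_uncurry_oseenDuhamel hwm hvtm 1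
    have h3 : Measurable (uncurry (oseenDuhamel 1 0 w w)) := measurable_uncurry_oseenDuhamel hwm hwm 1
    have hS : MeasurableSet {q : ℝ × E | q.1 ∈ Ioc 0 T} := measurableSet_Ioc.preimage measurable_fst
    have heq : uncurry (Φ w) = fun q : ℝ × E => if q.1 ∈ Ioc 0 T then
        uncurry g q - uncurry (oseenDuhamel 1 0 vt w) q - uncurry (oseenDuhamel 1 0 w vt) q -
          uncurry (oseenDuhamel 1 0 w w) q else 0 := by
      funext q; rfl
    rw [heq]
    exact Measurable.ite hS (((hgm.sub h1).sub h2).sub h3) measurable_const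
  -- ### (S3)/(S4): bounds and differences of the iterates against the chain `D`
  have hreal : ∀ {j : ℕ}, (∀ t ∈ Ioc 0 T, ∀ x, ‖W j t x‖ₑ ≤ ∑ i ∈ Finset.range j, D i t) →
      ∀ t ∈ Ioc 0 T, ∀ x, ‖W j t x‖ ≤ t ^ (a - 1 / 2) := by
    intro j hj t ht x
    have h1 : ‖W j t x‖ₑ ≤ ENNReal.ofReal (t ^ (a - 1 / 2)) :=
      (hj t ht x).trans ((ENNReal.sum_le_tsum _).trans (hsumD_le t ht))
    rw [← ofReal_norm] at h1
    exact (ENNReal.ofReal_le_ofReal_iff (Real.rpow_nonneg ht.1.le _)).1 h1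
  have claim : ∀ k, Measurable (uncurry (W k)) ∧ Measurable (uncurry (W (k + 1))) ∧
      (∀ t ∈ Ioc 0 T, ∀ x, ‖W k t x‖ₑ ≤ ∑ j ∈ Finset.range k, D j t) ∧
      (∀ t ∈ Ioc 0 T, ∀ x, ‖W (k + 1) t x‖ₑ ≤ ∑ j ∈ Finset.range (k + 1), D j t) ∧
      (∀ t ∈ Ioc 0 T, ∀ x, ‖W (k + 1) t x - W k t x‖ₑ ≤ D k t) := by
    intro k
    induction k with
    | zero =>
      have hm0 : Measurable (uncurry (W 0)) := by rw [hW0]; exact measurable_const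
      have hm1 : Measurable (uncurry (W 1)) := by rw [hWsucc]; exact hΦm hm0
      have hW1 : ∀ t ∈ Ioc 0 T, ∀ x, W 1 t x = g t x := by
        intro t ht x
        rw [hW_in 0 t ht x, hW0]
        simp only [oseenDuhamel_zero_left, oseenDuhamel_zero_right, Pi.zero_apply, sub_zero]
      refine ⟨hm0, hm1, ?_, ?_, ?_⟩
      · intro t ht x; simp [hW0]
      · intro t ht x
        rw [Finset.sum_range_one, hW1 t ht x, hD0 t ht.1, ← ofReal_norm]
        exact ENNReal.ofReal_le_ofReal (hg t ht x)
      · intro t ht x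
        rw [hW1 t ht x, hW0]
        simp only [Pi.zero_apply, sub_zero]
        rw [hD0 t ht.1, ← ofReal_norm]
        exact ENNReal.ofReal_le_ofReal (hg t ht x)
    | succ k ih =>
      obtain ⟨hmk, hmk1, hbk, hbk1, hdk⟩ := ih
      have hmk2 : Measurable (uncurry (W (k + 1 + 1))) := by rw [hWsucc]; exact hΦm hmk1
      have hdiff : ∀ t ∈ Ioc 0 T, ∀ x, ‖W (k + 1 + 1) t x - W (k + 1) t x‖ₑ ≤ D (k + 1) t := by
        intro t ht x
        have hcore := enorm_quadratic_sub_le hC₀0 hC₀ hT1 ha ha2 hν0 h313a hvtm hmk1 hmk hvt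
          (hreal hbk1) (hreal hbk) (hD_fin k) hdk ht x
        have heq : W (k + 1 + 1) t x - W (k + 1) t x =
            -((oseenDuhamel 1 0 vt (W (k + 1)) t x + oseenDuhamel 1 0 (W (k + 1)) vt t x +
                oseenDuhamel 1 0 (W (k + 1)) (W (k + 1)) t x) -
              (oseenDuhamel 1 0 vt (W k) t x + oseenDuhamel 1 0 (W k) vt t x +
                oseenDuhamel 1 0 (W k) (W k) t x)) := by
          rw [hW_in (k + 1) t ht x, hW_in k t ht x]; abel
        rw [heq, enorm_neg, ← hD_succ]
        exact hcore
      refine ⟨hmk1, hmk2, hbk1, ?_, hdiff⟩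
      intro t ht x
      calc ‖W (k + 1 + 1) t x‖ₑ = ‖W (k + 1) t x + (W (k + 1 + 1) t x - W (k + 1) t x)‖ₑ := by
            congr 1; abel
        _ ≤ ‖W (k + 1) t x‖ₑ + ‖W (k + 1 + 1) t x - W (k + 1) t x‖ₑ := enorm_add_le _ _
        _ ≤ ∑ j ∈ Finset.range (k + 1), D j t + D (k + 1) t :=
            add_le_add (hbk1 t ht x) (hdiff t ht x)
        _ = ∑ j ∈ Finset.range (k + 1 + 1), D j t :=
            (Finset.sum_range_succ (fun j => D j t) (k + 1)).symm
  have hm : ∀ k, Measurable (uncurry (W k)) := fun k => (claim k).1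
  have hWb : ∀ k, ∀ t ∈ Ioc 0 T, ∀ x, ‖W k t x‖ₑ ≤ ∑ j ∈ Finset.range k, D j t :=
    fun k => (claim k).2.2.1
  have hWd : ∀ k, ∀ t ∈ Ioc 0 T, ∀ x, ‖W (k + 1) t x - W k t x‖ₑ ≤ D k t :=
    fun k => (claim k).2.2.2.2
  have hWreal : ∀ k, ∀ t ∈ Ioc 0 T, ∀ x, ‖W k t x‖ ≤ t ^ (a - 1 / 2) := fun k => hreal (hWb k)
  -- ### (S5) pointwise convergence of the iterates
  have hdist : ∀ t ∈ Ioc 0 T, ∀ x, ∀ k, dist (W k t x) (W (k + 1) t x) ≤ (D k t).toReal := by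
    intro t ht x k
    rw [dist_comm, dist_eq_norm]
    exact norm_le_toReal_of_enorm_le (hWd k t ht x) (hD_fin k t ht)
  have htsum_fin : ∀ t ∈ Ioc 0 T, ∑' k, D k t ≠ ∞ := fun t ht =>
    ne_top_of_le_ne_top ENNReal.ofReal_ne_top (hD_tsum t ht)
  have hsumm : ∀ t ∈ Ioc 0 T, Summable (fun k => (D k t).toReal) := fun t ht =>
    ENNReal.summable_toReal (htsum_fin t ht)
  have hcauchy : ∀ t ∈ Ioc 0 T, ∀ x, CauchySeq (fun k => W k t x) := fun t ht x =>
    cauchySeq_of_dist_le_of_summable _ (hdist t ht x) (hsumm t ht)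
  set wlim : ℝ → E → E := fun t x =>
    if t ∈ Ioc 0 T then limUnder atTop (fun k => W k t x) else 0 with hwlim
  have hconv : ∀ t ∈ Ioc 0 T, ∀ x, Tendsto (fun k => W k t x) atTop (𝓝 (wlim t x)) := by
    intro t ht x
    have h := (hcauchy t ht x).tendsto_limUnder
    simp only [hwlim, if_pos ht]
    exact h
  -- the tails of the majorant series
  set Tail : ℕ → ℝ → ℝ≥0∞ := fun k τ => ∑' m, D (m + k) τ with hTail
  have hTail_le : ∀ k, ∀ τ ∈ Ioc 0 T, Tail k τ ≤ ∑' m, D m τ := fun k τ _ =>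
    ENNReal.tsum_comp_le_tsum_of_injective (add_left_injective k) (fun m => D m τ)
  have hTail_fin : ∀ k, ∀ τ ∈ Ioc 0 T, Tail k τ ≠ ∞ := fun k τ hτ =>
    ne_top_of_le_ne_top (htsum_fin τ hτ) (hTail_le k τ hτ)
  have htail : ∀ k, ∀ t ∈ Ioc 0 T, ∀ x, ‖wlim t x - W k t x‖ₑ ≤ Tail k t := by
    intro k t ht x
    have h := dist_le_tsum_of_dist_le_of_tendsto _ (hdist t ht x) (hsumm t ht) (hconv t ht x) k
    rw [dist_comm, dist_eq_norm, tsum_congr (fun m => by rw [add_comm])] at h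
    rw [← ofReal_norm]
    calc ENNReal.ofReal ‖wlim t x - W k t x‖
        ≤ ENNReal.ofReal (∑' m, (D (m + k) t).toReal) := ENNReal.ofReal_le_ofReal h
      _ = Tail k t := by
          rw [← ENNReal.tsum_toReal_eq (fun m => hD_fin (m + k) t ht),
            ENNReal.ofReal_toReal (hTail_fin k t ht)]
  -- measurability of the limit
  have hwlim_m : Measurable (uncurry wlim) := by
    set S : Set (ℝ × E) := Ioc 0 T ×ˢ univ with hS
    have hSm : MeasurableSet S := measurableSet_Ioc.prod MeasurableSet.univ
    set G : ℕ → ℝ × E → E := fun n q => if q ∈ S then uncurry (W n) q else 0 with hG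
    have hGm : ∀ n, Measurable (G n) := fun n => Measurable.ite hSm (hm n) measurable_const
    have hlim : Tendsto G atTop (𝓝 (uncurry wlim)) := by
      rw [tendsto_pi_nhds]
      intro q
      by_cases hq : q ∈ S
      · have hq1 : q.1 ∈ Ioc 0 T := (mem_prod.1 hq).1
        have h := hconv q.1 hq1 q.2
        have heq : (fun n => G n q) = fun n => W n q.1 q.2 := by
          funext n; simp only [hG, if_pos hq, uncurry]
        rw [heq]
        exact h
      · have heq : (fun n => G n q) = fun _ => (0 : E) := by
          funext n; simp only [hG, if_neg hq]
        have hq1 : q.1 ∉ Ioc 0 T := fun h => hq (mem_prod.2 ⟨h, mem_univ _⟩)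
        have hval : uncurry wlim q = 0 := by
          simp only [uncurry, hwlim, if_neg hq1]
        rw [heq, hval]
        exact tendsto_const_nhds
    exact measurable_of_tendsto_metrizable hGm hlim
  -- the bound of the limit
  have hwlim_b : ∀ t ∈ Ioc 0 T, ∀ x, ‖wlim t x‖ ≤ g₀ * CR * t ^ (a - 1 / 2) := by
    intro t ht x
    have hk : ∀ k, ‖W k t x‖ ≤ g₀ * CR * t ^ (a - 1 / 2) := by
      intro k
      have h1 : ‖W k t x‖ₑ ≤ ENNReal.ofReal (g₀ * CR * t ^ (a - 1 / 2)) :=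
        (hWb k t ht x).trans ((ENNReal.sum_le_tsum _).trans (hD_tsum t ht))
      rw [← ofReal_norm] at h1
      exact (ENNReal.ofReal_le_ofReal_iff (by
        have := Real.rpow_nonneg ht.1.le (a - 1 / 2); positivity)).1 h1
    exact le_of_tendsto ((continuous_norm.tendsto _).comp (hconv t ht x))
      (Eventually.of_forall hk)
  have hwlim_real : ∀ t ∈ Ioc 0 T, ∀ x, ‖wlim t x‖ ≤ t ^ (a - 1 / 2) := by
    intro t ht x
    calc ‖wlim t x‖ ≤ g₀ * CR * t ^ (a - 1 / 2) := hwlim_b t ht x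
      _ ≤ 1 * t ^ (a - 1 / 2) := mul_le_mul_of_nonneg_right hsmall (Real.rpow_nonneg ht.1.le _)
      _ = _ := one_mul _
  -- ### the fixed point equation
  have hKop_Tail : ∀ k t, Kop (Tail k) t = Tail (k + 1) t := by
    intro k t
    simp only [hTail, hKop]
    have h1 : ∀ s, ENNReal.ofReal (2 * C₀ * (t - s) ^ (-(1 / 2 : ℝ)) * (ν s + s ^ (a - 1 / 2))) *
        ∑' m, D (m + k) s =
        ∑' m, ENNReal.ofReal (2 * C₀ * (t - s) ^ (-(1 / 2 : ℝ)) * (ν s + s ^ (a - 1 / 2))) *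
          D (m + k) s := fun s => ENNReal.tsum_mul_left.symm
    simp_rw [h1]
    rw [lintegral_tsum (f := fun m s => ENNReal.ofReal (2 * C₀ * (t - s) ^ (-(1 / 2 : ℝ)) *
      (ν s + s ^ (a - 1 / 2))) * D (m + k) s) (fun m => ?_)]
    · refine tsum_congr fun m => ?_
      exact hD_succ (m + k) t
    · exact (((hκm.comp (measurable_const.prodMk measurable_id)).mul (hD_meas _)).aemeasurable)
  have hTail0 : ∀ t ∈ Ioc 0 T, Tendsto (fun k => Tail k t) atTop (𝓝 0) := fun t ht =>
    ENNReal.tendsto_sum_nat_add (fun m => D m t) (htsum_fin t ht)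
  have hfix : ∀ t ∈ Ioc 0 T, ∀ x, wlim t x = g t x - oseenDuhamel 1 0 vt wlim t x -
      oseenDuhamel 1 0 wlim vt t x - oseenDuhamel 1 0 wlim wlim t x := by
    intro t ht x
    set Fx : E := g t x - oseenDuhamel 1 0 vt wlim t x - oseenDuhamel 1 0 wlim vt t x -
      oseenDuhamel 1 0 wlim wlim t x with hFx
    have hkey : ∀ k, ‖Fx - W (k + 1) t x‖ₑ ≤ Tail (k + 1) t := by
      intro k
      have hcore := enorm_quadratic_sub_le hC₀0 hC₀ hT1 ha ha2 hν0 h313a hvtm hwlim_m (hm k) hvt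
        hwlim_real (hWreal k) (hTail_fin k) (htail k) ht x
      have heq : Fx - W (k + 1) t x =
          -((oseenDuhamel 1 0 vt wlim t x + oseenDuhamel 1 0 wlim vt t x +
              oseenDuhamel 1 0 wlim wlim t x) -
            (oseenDuhamel 1 0 vt (W k) t x + oseenDuhamel 1 0 (W k) vt t x +
              oseenDuhamel 1 0 (W k) (W k) t x)) := by
        rw [hFx, hW_in k t ht x]; abel
      rw [heq, enorm_neg, ← hKop_Tail]
      exact hcore
    have hlim1 : Tendsto (fun k => W (k + 1) t x) atTop (𝓝 (wlim t x)) :=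
      (hconv t ht x).comp (tendsto_add_atTop_nat 1)
    have hlim2 : Tendsto (fun k => W (k + 1) t x) atTop (𝓝 Fx) := by
      rw [tendsto_iff_norm_sub_tendsto_zero]
      have hb : ∀ k, ‖W (k + 1) t x - Fx‖ ≤ (Tail (k + 1) t).toReal := by
        intro k
        rw [← norm_neg, neg_sub]
        exact norm_le_toReal_of_enorm_le (hkey k) (hTail_fin (k + 1) t ht)
      have h0 : Tendsto (fun k => (Tail (k + 1) t).toReal) atTop (𝓝 0) := by
        have h := (ENNReal.tendsto_toReal ENNReal.zero_ne_top).comp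
          ((hTail0 t ht).comp (tendsto_add_atTop_nat 1))
        rw [ENNReal.toReal_zero] at h
        exact h
      exact squeeze_zero (fun k => norm_nonneg _) hb h0
    exact tendsto_nhds_unique hlim1 hlim2
  -- ### periodicity
  have hper : ∀ h : E, (∀ t y, vt t (y + h) = vt t y) → (∀ t y, g t (y + h) = g t y) →
      ∀ t y, wlim t (y + h) = wlim t y := by
    intro h hvh hgh
    have hvfun : (fun τ z => vt τ (z + h)) = vt := by funext τ z; exact hvh τ z
    have hW_per : ∀ k, ∀ t y, W k t (y + h) = W k t y := by
      intro k
      induction k with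
      | zero => intro t y; rfl
      | succ k ih =>
        intro t y
        have hWfun : (fun τ z => W k τ (z + h)) = W k := by funext τ z; exact ih τ z
        rw [hWsucc]
        simp only [hΦ]
        by_cases hts : t ∈ Ioc 0 T
        · rw [if_pos hts, if_pos hts, hgh t y,
            ← oseenDuhamel_comp_add_right 1 0 vt (W k) h t y,
            ← oseenDuhamel_comp_add_right 1 0 (W k) vt h t y,
            ← oseenDuhamel_comp_add_right 1 0 (W k) (W k) h t y, hvfun, hWfun]
        · rw [if_neg hts, if_neg hts]
    intro t y
    by_cases hts : t ∈ Ioc 0 T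
    · simp only [hwlim, if_pos hts]
      have : (fun k => W k t (y + h)) = fun k => W k t y := by funext k; exact hW_per k t y
      rw [this]
    · simp only [hwlim, if_neg hts]
  -- ### conclusion
  refine ⟨wlim, hwlim_m, hwlim_b, hfix, fun t ht x => ?_, hper⟩
  simp only [hwlim, if_neg ht]

end CP25Picard

end Literature.Analysis.FluidPDE
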